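import Summits.Schanuel.Schanuel.Theorems.ZilberEacPuiseuxBranches
import Mathlib.Analysis.Calculus.ImplicitContDiff
import Mathlib.Analysis.Analytic.Order
import Mathlib.Algebra.Polynomial.Taylor
import Mathlib.Algebra.Polynomial.Roots
import HarnessLib

/-!
# Arbitrary base branches, XC (a): tools for the ANALYTIC NEWTON–PUISEUX THEOREM — the implicit
# function theorem for a polynomial with analytic rows, the order bound forced by a Bézout
# identity, an irreducible factor through the origin, Taylor expansion in the second variable

HONEST FRAMING.  Cell `pub-schanuel` (Zilber's Exponential-Algebraic Closedness, case ladder;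
host summit Schanuel), seat 2, gen 33.  Lemmas for file XC (b) (`ZilberEacAnalyticPuiseux`: a
polynomial with ANALYTIC rows has a convergent Puiseux root):
* `exists_analytic_root_of_simple` — `Σ_j b_j(σ) u^j = 0` with `b_j` analytic and a SIMPLE root
  `u₀` at `σ = 0` has an analytic root germ `u(σ)`, `u(0) = u₀` (Mathlib's
  `ContDiffAt.implicitFunction`);
* `exists_pow_mul_le_of_relation` — if `α·σ^{N'}ĉ + β·D = σ^{ρ'} r₁` (`r₁(0) ≠ 0`, `ρ' < N'`) then
  `D = σ^a D₁`, `D₁(0) ≠ 0`, `a ≤ ρ'` (the order bound that makes the Newton–Hensel step work);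
* `exists_irreducible_factor_root_zero` — a monic `G ∈ ℂ[s][t]` with `G(0,0) = 0`, `G(s,0) ≢ 0`
  has an irreducible factor of positive `t`-degree through the origin (input shape of gen 26's
  `exists_zeroBranch_puiseux`);
* the row-polynomial calculus `Σ_{j ≤ d} C(a_j) X^j` (evaluation, derivative, coefficients,
  degree) and Taylor's expansion `p(r + v) = Σ_i (H_i p)(r) v^i` through Hasse derivatives.
[folklore]; nothing here is specific to Schanuel's conjecture (neither used nor implied);
Mantova–Masser's question (PLMS 2024 §1 p. 5) and EC(3,2) stay OPEN; EAC ⇏ SC.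
-/

noncomputable section

open Filter Topology Polynomial
open scoped ContDiff

set_option linter.dupNamespace false

namespace Summit.Schanuel.Schanuel.Theorems

/-! ## Part A. Analytic helpers -/

/-- An analytic germ not identically zero is `z^n · g` with `g(0) ≠ 0`. [folklore] -/
theorem exists_eq_pow_mul_of_not_eventually_zero {f : ℂ → ℂ} (hf : AnalyticAt ℂ f 0)
    (hf0 : ¬ ∀ᶠ z in 𝓝 (0 : ℂ), f z = 0) :
    ∃ (n : ℕ) (g : ℂ → ℂ), AnalyticAt ℂ g 0 ∧ g 0 ≠ 0 ∧ ∀ᶠ z in 𝓝 (0 : ℂ), f z = z ^ n * g z := by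
  have hne : analyticOrderAt f 0 ≠ ⊤ := by rwa [Ne, analyticOrderAt_eq_top]
  obtain ⟨g, hg, hg0, hfg⟩ := hf.analyticOrderAt_ne_top.1 hne
  refine ⟨analyticOrderNatAt f 0, g, hg, hg0, ?_⟩
  filter_upwards [hfg] with z hz
  rw [hz, sub_zero, smul_eq_mul]

/-- `σ ↦ σ^e` maps the neighbourhood filter of `0` into itself. [folklore] -/
theorem tendsto_pow_nhds_zero (e : ℕ) (he : 1 ≤ e) :
    Tendsto (fun σ : ℂ => σ ^ e) (𝓝 (0 : ℂ)) (𝓝 (0 : ℂ)) := by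
  have h := (continuous_pow e (M := ℂ)).tendsto (0 : ℂ)
  rwa [zero_pow (by omega : e ≠ 0)] at h

/-- **Implicit function theorem for a polynomial with analytic rows.**  `b_j` analytic at `0`
(`j ≤ d`), `u₀` a SIMPLE root of `Σ_j b_j(0) u^j`: there is `u` analytic at `0`, `u(0) = u₀`, with
`Σ_j b_j(σ) u(σ)^j = 0` near `σ = 0`.  (Mathlib's `ContDiffAt.implicitFunction`.) [folklore] -/
theorem exists_analytic_root_of_simple (d : ℕ) (b : ℕ → ℂ → ℂ) (hban : ∀ j, AnalyticAt ℂ (b j) 0)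
    {u₀ : ℂ} (hroot : ∑ j ∈ Finset.range (d + 1), b j 0 * u₀ ^ j = 0)
    (hsimple : ∑ j ∈ Finset.range (d + 1), (j : ℂ) * b j 0 * u₀ ^ (j - 1) ≠ 0) :
    ∃ u : ℂ → ℂ, AnalyticAt ℂ u 0 ∧ u 0 = u₀ ∧
      ∀ᶠ σ in 𝓝 (0 : ℂ), ∑ j ∈ Finset.range (d + 1), b j σ * u σ ^ j = 0 := by
  classical
  set Φ : ℂ × ℂ → ℂ := fun v => ∑ j ∈ Finset.range (d + 1), b j v.1 * v.2 ^ j with hΦ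
  have hΦat : ContDiffAt ℂ ω Φ (0, u₀) := by
    simp only [hΦ]
    refine ContDiffAt.sum fun j _ => ContDiffAt.mul ?_ (contDiffAt_snd.pow _)
    have h1 : ContDiffAt ℂ ω (b j) (Prod.fst ((0 : ℂ), u₀)) := (hban j).contDiffAt
    exact h1.comp (0, u₀) contDiffAt_fst
  -- the polynomial `p₀(u) = Σ b_j(0) u^j` and the partial derivative in `u`
  set p₀ : ℂ[X] := ∑ j ∈ Finset.range (d + 1), Polynomial.C (b j 0) * Polynomial.X ^ j with hp₀
  have hp₀eval : ∀ y : ℂ, p₀.eval y = ∑ j ∈ Finset.range (d + 1), b j 0 * y ^ j := by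
    intro y
    rw [hp₀, Polynomial.eval_finsetSum]
    simp only [Polynomial.eval_mul, Polynomial.eval_C, Polynomial.eval_pow, Polynomial.eval_X]
  have hp₀der : ∀ y : ℂ, (derivative p₀).eval y =
      ∑ j ∈ Finset.range (d + 1), (j : ℂ) * b j 0 * y ^ (j - 1) := by
    intro y
    rw [hp₀, Polynomial.derivative_sum, Polynomial.eval_finsetSum]
    refine Finset.sum_congr rfl fun j _ => ?_
    rw [Polynomial.derivative_C_mul_X_pow, Polynomial.eval_mul, Polynomial.eval_C,
      Polynomial.eval_pow, Polynomial.eval_X]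
    ring
  have hΦeq0 : ∀ y : ℂ, Φ (0, y) = p₀.eval y := fun y => by rw [hp₀eval]
  have hΦa : Φ (0, u₀) = 0 := by rw [hΦeq0, hp₀eval]; exact hroot
  have hcomp : HasFDerivAt (fun y : ℂ => Φ (0, y))
      ((fderiv ℂ Φ (0, u₀)).comp (ContinuousLinearMap.inr ℂ ℂ ℂ)) u₀ :=
    (hΦat.differentiableAt (by simp)).hasFDerivAt.comp u₀ (hasFDerivAt_prodMk_right (0 : ℂ) u₀)
  have hTd : HasFDerivAt (fun y : ℂ => Φ (0, y))
      (ContinuousLinearMap.smulRight (1 : ℂ →L[ℂ] ℂ) ((derivative p₀).eval u₀)) u₀ := by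
    have e : (fun y : ℂ => Φ (0, y)) = fun y => p₀.eval y := funext fun y => hΦeq0 y
    rw [e]
    exact (Polynomial.hasDerivAt p₀ u₀).hasFDerivAt
  have hD2 : (fderiv ℂ Φ (0, u₀)).comp (ContinuousLinearMap.inr ℂ ℂ ℂ) =
      ContinuousLinearMap.smulRight (1 : ℂ →L[ℂ] ℂ) ((derivative p₀).eval u₀) := hcomp.unique hTd
  have hder0 : (derivative p₀).eval u₀ ≠ 0 := by rw [hp₀der]; exact hsimple
  have hinv : ((fderiv ℂ Φ (0, u₀)).comp (ContinuousLinearMap.inr ℂ ℂ ℂ)).IsInvertible := by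
    rw [hD2]
    refine ⟨ContinuousLinearEquiv.unitsEquivAut ℂ (Units.mk0 _ hder0), ?_⟩
    ext
    simp [ContinuousLinearEquiv.unitsEquivAut_apply]
  have hω : (ω : ℕ∞ω) ≠ 0 := by simp
  set u : ℂ → ℂ := hΦat.implicitFunction hω hinv with hu
  refine ⟨u, (hΦat.contDiffAt_implicitFunction hω hinv).analyticAt,
    hΦat.implicitFunction_apply_self hω hinv, ?_⟩
  have h := hΦat.eventually_apply_implicitFunction hω hinv
  rw [hΦa] at h
  filter_upwards [h] with σ hσ
  exact hσ

/-! ## Part B. The order bound forced by a Bézout identity; an irreducible factor through the origin -/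

/-- **Order bound.**  If `α·(σ^{N'} ĉ) + β·D = σ^{ρ'} r₁` near `σ = 0` (`σ ≠ 0`) with everything
analytic, `r₁(0) ≠ 0` and `ρ' < N'`, then `D = σ^a D₁` with `D₁(0) ≠ 0` and `a ≤ ρ'`. [folklore] -/
theorem exists_pow_mul_le_of_relation {α ĉ β D r₁ : ℂ → ℂ} (hα : AnalyticAt ℂ α 0)
    (hĉ : AnalyticAt ℂ ĉ 0) (hβ : AnalyticAt ℂ β 0) (hD : AnalyticAt ℂ D 0) (hr₁ : AnalyticAt ℂ r₁ 0)
    (hr₁0 : r₁ 0 ≠ 0) {N' ρ' : ℕ} (hN : ρ' < N')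
    (hid : ∀ᶠ σ in 𝓝[≠] (0 : ℂ), α σ * (σ ^ N' * ĉ σ) + β σ * D σ = σ ^ ρ' * r₁ σ) :
    ∃ (a : ℕ) (D₁ : ℂ → ℂ), a ≤ ρ' ∧ AnalyticAt ℂ D₁ 0 ∧ D₁ 0 ≠ 0 ∧
      ∀ᶠ σ in 𝓝 (0 : ℂ), D σ = σ ^ a * D₁ σ := by
  by_cases h : ((ρ' + 1 : ℕ) : ℕ∞) ≤ analyticOrderAt D 0
  · -- too high an order contradicts `r₁(0) ≠ 0`
    exfalso
    obtain ⟨g, hg, hDg⟩ := (natCast_le_analyticOrderAt hD).1 h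
    set G : ℂ → ℂ := fun σ => α σ * σ ^ (N' - ρ' - 1) * ĉ σ + β σ * g σ with hG
    have hGan : AnalyticAt ℂ G 0 :=
      ((hα.mul (analyticAt_id.pow _)).mul hĉ).add (hβ.mul hg)
    have hrel : ∀ᶠ σ in 𝓝[≠] (0 : ℂ), r₁ σ = σ * G σ := by
      filter_upwards [hid, nhdsWithin_le_nhds hDg, self_mem_nhdsWithin] with σ hσ hDσ (hσ0 : σ ≠ 0)
      rw [sub_zero, smul_eq_mul] at hDσ
      have hpow : σ ^ N' = σ ^ ρ' * (σ * σ ^ (N' - ρ' - 1)) := by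
        rw [← pow_succ', ← pow_add]
        congr 1
        omega
      have h2 : σ ^ ρ' * r₁ σ = σ ^ ρ' * (σ * G σ) := by
        rw [← hσ, hDσ, hG, hpow, pow_succ]
        ring
      exact mul_left_cancel₀ (pow_ne_zero _ hσ0) h2
    have h1 : Tendsto r₁ (𝓝[≠] (0 : ℂ)) (𝓝 (r₁ 0)) :=
      hr₁.continuousAt.tendsto.mono_left nhdsWithin_le_nhds
    have h2 : Tendsto (fun σ : ℂ => σ * G σ) (𝓝[≠] (0 : ℂ)) (𝓝 (0 * G 0)) :=
      ((continuous_id.tendsto (0 : ℂ)).mul hGan.continuousAt.tendsto).mono_left nhdsWithin_le_nhds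
    rw [zero_mul] at h2
    exact hr₁0 (tendsto_nhds_unique (h1.congr' hrel) h2)
  · have hne : analyticOrderAt D 0 ≠ ⊤ := by
      intro htop
      exact h (htop ▸ le_top)
    obtain ⟨D₁, hD₁, hD₁0, hfac⟩ := hD.analyticOrderAt_ne_top.1 hne
    refine ⟨analyticOrderNatAt D 0, D₁, ?_, hD₁, hD₁0, ?_⟩
    · have h' : analyticOrderAt D 0 < ((ρ' + 1 : ℕ) : ℕ∞) := not_le.1 h
      rw [← Nat.cast_analyticOrderNatAt hne] at h'
      have := ENat.coe_lt_coe.1 h'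
      omega
    · filter_upwards [hfac] with σ hσ
      rw [hσ, sub_zero, smul_eq_mul]

/-- **An irreducible factor through the origin.**  A monic `G ∈ ℂ[s][t]` with `G(0, 0) = 0` and
`G(s, 0) ≢ 0` has an irreducible factor `Q₁` of positive `t`-degree with `Q₁(0, 0) = 0`,
`Q₁(s, 0) ≢ 0`. [folklore] -/
theorem exists_irreducible_factor_root_zero (G : ℂ[X][X]) (hG : G.Monic) (hc0 : G.coeff 0 ≠ 0)
    (h0 : (G.coeff 0).IsRoot 0) :
    ∃ Q₁ : ℂ[X][X], Irreducible Q₁ ∧ Q₁ ∣ G ∧ Q₁.natDegree ≠ 0 ∧ Q₁.coeff 0 ≠ 0 ∧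
      (Q₁.coeff 0).IsRoot 0 := by
  classical
  have hG0 : G ≠ 0 := hG.ne_zero
  set ev : ℂ[X][X] →+* ℂ := (Polynomial.evalRingHom (0 : ℂ)).comp (Polynomial.evalRingHom (0 : ℂ[X]))
    with hev
  have hev_apply : ∀ H : ℂ[X][X], ev H = (H.coeff 0).eval 0 := by
    intro H
    rw [hev, RingHom.comp_apply, Polynomial.coe_evalRingHom, Polynomial.coe_evalRingHom,
      Polynomial.coeff_zero_eq_eval_zero]
  have hevG : ev G = 0 := by rw [hev_apply]; exact h0
  obtain ⟨u, hu⟩ := UniqueFactorizationMonoid.factors_prod hG0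
  have hprod : ev (UniqueFactorizationMonoid.factors G).prod = 0 := by
    have h1 : ev (UniqueFactorizationMonoid.factors G).prod * ev (u : ℂ[X][X]) = 0 := by
      rw [← map_mul, hu, hevG]
    exact (mul_eq_zero.1 h1).resolve_right (u.isUnit.map ev).ne_zero
  rw [map_multiset_prod, Multiset.prod_eq_zero_iff, Multiset.mem_map] at hprod
  obtain ⟨Q₁, hmem, hQ₁⟩ := hprod
  have hirr : Irreducible Q₁ := UniqueFactorizationMonoid.irreducible_of_factor _ hmem
  have hdvd : Q₁ ∣ G := UniqueFactorizationMonoid.dvd_of_mem_factors hmem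
  have hroot : (Q₁.coeff 0).IsRoot 0 := by
    rw [Polynomial.IsRoot, ← hev_apply]; exact hQ₁
  have hc0' : Q₁.coeff 0 ≠ 0 := by
    obtain ⟨H, hH⟩ := hdvd
    intro h
    apply hc0
    rw [hH, Polynomial.mul_coeff_zero, h, zero_mul]
  refine ⟨Q₁, hirr, hdvd, ?_, hc0', hroot⟩
  intro hdeg
  have hQC : Q₁ = Polynomial.C (Q₁.coeff 0) := Polynomial.eq_C_of_natDegree_eq_zero hdeg
  have hdvd' : Polynomial.C (Q₁.coeff 0) ∣ G := by rw [← hQC]; exact hdvd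
  have hunit : IsUnit (Q₁.coeff 0) := by
    have h1 := (Polynomial.C_dvd_iff_dvd_coeff _ _).1 hdvd' G.natDegree
    rw [hG.coeff_natDegree] at h1
    exact isUnit_of_dvd_one h1
  exact (hunit.map (Polynomial.evalRingHom (0 : ℂ))).ne_zero hroot

/-! ## Part C. Calculus of a polynomial with rows `a_j`: `Σ_{j ≤ d} C(a_j) X^j` -/

/-- Evaluation of the row polynomial. [folklore] -/
theorem eval_rowPoly (d : ℕ) (a : ℕ → ℂ) (y : ℂ) :
    (∑ j ∈ Finset.range (d + 1), Polynomial.C (a j) * Polynomial.X ^ j : ℂ[X]).eval y =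
      ∑ j ∈ Finset.range (d + 1), a j * y ^ j := by
  rw [Polynomial.eval_finsetSum]
  simp only [Polynomial.eval_mul, Polynomial.eval_C, Polynomial.eval_pow, Polynomial.eval_X]

/-- Evaluation of the derivative of the row polynomial. [folklore] -/
theorem eval_derivative_rowPoly (d : ℕ) (a : ℕ → ℂ) (y : ℂ) :
    (derivative (∑ j ∈ Finset.range (d + 1), Polynomial.C (a j) * Polynomial.X ^ j : ℂ[X])).eval y =
      ∑ j ∈ Finset.range (d + 1), (j : ℂ) * a j * y ^ (j - 1) := by
  rw [Polynomial.derivative_sum, Polynomial.eval_finsetSum]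
  refine Finset.sum_congr rfl fun j _ => ?_
  rw [Polynomial.derivative_C_mul_X_pow, Polynomial.eval_mul, Polynomial.eval_C,
    Polynomial.eval_pow, Polynomial.eval_X]
  ring

/-- Coefficients of the row polynomial. [folklore] -/
theorem coeff_rowPoly (d : ℕ) (a : ℕ → ℂ) (m : ℕ) :
    (∑ j ∈ Finset.range (d + 1), Polynomial.C (a j) * Polynomial.X ^ j : ℂ[X]).coeff m =
      if m < d + 1 then a m else 0 := by
  rw [Polynomial.finsetSum_coeff]
  simp only [Polynomial.coeff_C_mul_X_pow]
  rw [Finset.sum_ite_eq (Finset.range (d + 1)) m a]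
  simp only [Finset.mem_range]

/-- The row polynomial has degree `≤ d`. [folklore] -/
theorem natDegree_rowPoly_le (d : ℕ) (a : ℕ → ℂ) :
    (∑ j ∈ Finset.range (d + 1), Polynomial.C (a j) * Polynomial.X ^ j : ℂ[X]).natDegree ≤ d := by
  rw [Polynomial.natDegree_le_iff_coeff_eq_zero]
  intro m hm
  rw [coeff_rowPoly, if_neg]
  omega

/-- The Hasse derivative of a polynomial of degree `≤ d`, evaluated, as an explicit finite sum.
[folklore] -/
theorem eval_hasseDeriv_eq_sum {p : ℂ[X]} {d : ℕ} (hp : p.natDegree ≤ d) (i : ℕ) (r : ℂ) :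
    (hasseDeriv i p).eval r =
      ∑ n ∈ Finset.range (d + 1), ((n + i).choose i : ℂ) * p.coeff (n + i) * r ^ n := by
  have hdeg : (hasseDeriv i p).natDegree < d + 1 :=
    lt_of_le_of_lt ((Polynomial.natDegree_hasseDeriv_le p i).trans (by omega)) (Nat.lt_succ_of_le hp)
  rw [Polynomial.eval_eq_sum_range' hdeg]
  refine Finset.sum_congr rfl fun n _ => ?_
  rw [Polynomial.hasseDeriv_coeff]

/-- **Taylor expansion in the second variable**: `p(r + v) = Σ_{i ≤ d} (H_i p)(r) v^i` for `p` of
degree `≤ d` (`H_i` the Hasse derivatives). [folklore] -/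
theorem eval_add_eq_sum_hasseDeriv {p : ℂ[X]} {d : ℕ} (hp : p.natDegree ≤ d) (r v : ℂ) :
    p.eval (r + v) = ∑ i ∈ Finset.range (d + 1), (hasseDeriv i p).eval r * v ^ i := by
  have hdeg : (taylor r p).natDegree < d + 1 := by
    rw [Polynomial.natDegree_taylor]; omega
  rw [add_comm, ← Polynomial.taylor_eval, Polynomial.eval_eq_sum_range' hdeg]
  refine Finset.sum_congr rfl fun i _ => ?_
  rw [Polynomial.taylor_coeff]

end Summit.Schanuel.Schanuel.Theorems
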